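import Literature.AlgebraicGeometry.Frobenioids.DivisorMonoidCategoryTheoreticityCorProofsII
import HarnessLib

/-!
# Frobenioids I, Corollary 4.11 (iv) — PROOF modulo Corollary 4.11 (ii), a divisor-compatible `Ψ^Φ`
# (Theorem 4.9) and the preservation of Frobenius degrees (Theorem 3.4 (iii))

Mochizuki, *The geometry of Frobenioids I: the general theory*, Kyushu J. Math. **62** (2008)
293–400, kurims text proof of Cor. 4.11 (iv) p. 94: "In light of the structure of an elementary Frobenioid
[cf. Definition 1.1, (iii)], the existence of a 1-commutative diagram as in the statement of assertion
(iv) now follows simply by concatenating assertions (ii), (iii), with the fact that `Ψ` preserves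
Frobenius degrees [cf. Theorem 3.4, (iii)]" [cite: MochizukiFrdI2008, Cor. 4.11 (iv) p.94].

PROOF-ONLY companion of `DivisorMonoidCategoryTheoreticity.lean` (seat abc-iut-L1-t3):

* `cor411iv_of_cor411ii` (generic `PreFrobenioidData`): Cor. 4.11 (iv) AS TYPED from the typed Cor. 4.11
  (ii) for `Ψ`, an isomorphism `Ψ^Φ` over `Ψ` (Thm. 4.9) that is COMPATIBLE WITH DIVISORS
  (`Ψ^Φ_A(Div φ) = Div(Ψ φ)` — Thm. 4.9's `Ψ^Φ` is so constructed, p. 89, but the typed `Thm49` does not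
  record it, so it is an explicit hypothesis) and "`Ψ` preserves Frobenius degrees" (typed `PreservesDegFr`);
  the guarded rigidity conjunct of the typed (iv) (v2, cell FLAG #15: for slim `D₁, D₂`) is (ii)'s; the descent
  of `Ψ^Φ` to `D₁` is `DivisorMonoidIsoOver.exists_overBase`; print's own (iv) rigidity clause for the
  `F_Φ`-valued composites is the separate typed `Cor411ivRigid`, not treated here;
* `PreFrobenioid.cor411iv_of_fact`: the same for Frobenioids `C_i → F_{Φ_i}`, conditional on the named fact
  `FrdI.Cor411ii`.

No statement of the paper is strengthened; nothing here is specific to the abc programme.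
-/

namespace Literature.AlgebraicGeometry.Frobenioids

open CategoryTheory Opposite

universe w w₁ w₂ v v' v₁ v₁' v₂ v₂' u u' u₁ u₁' u₂ u₂'

namespace PreFrobenioidData

section TwoFrobenioids

variable {C₁ : Type u₁} [Category.{v₁} C₁] {D₁ : Type u₁'} [Category.{v₁'} D₁]
variable {C₂ : Type u₂} [Category.{v₂} C₂] {D₂ : Type u₂'} [Category.{v₂'} D₂]
variable (S₁ : PreFrobenioidData.{w₁} C₁ D₁) (S₂ : PreFrobenioidData.{w₂} C₂ D₂) (Ψ : C₁ ≌ C₂)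

/-- **Corollary 4.11 (iv)** AS TYPED, DISCHARGED modulo: the typed Cor. 4.11 (ii) for `Ψ`; an isomorphism
`Ψ^Φ : Φ₁ ⥲ Φ₂` over `Ψ` (Thm. 4.9) compatible with divisors, `Ψ^Φ_A (Div φ) = Div (Ψ φ)` (Thm. 4.9's `Ψ^Φ`
is so constructed, FrdI p. 89 — an explicit hypothesis, since the typed `Thm49` does not record it);
"`Ψ` preserves Frobenius degrees" (Thm. 3.4 (iii), (iv)) — the typed (ii) supplying `Ψ^Base`, `η` and the
(guarded, v2) rigidity of the composites `Base₂ ∘ Ψ`, `Ψ^Base ∘ Base₁` ("by concatenating assertions (ii),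
(iii), with the fact that `Ψ` preserves Frobenius degrees", p. 94) — for `C₁ → D₁` satisfying Def. 1.3
(i)(a)(b)(c) in operations form. [cite: MochizukiFrdI2008, Cor. 4.11 (iv) p.92] -/
theorem cor411iv_of_cor411ii (R₁ : S₁.RSParams) (R₂ : S₂.RSParams)
    (hbase : ∀ X : D₁, ∃ A : C₁, Nonempty (S₁.base.obj A ≅ X))
    (hconn : ∀ (A B : C₁) (g : S₁.base.obj A ≅ S₁.base.obj B), ∃ (X : C₁) (φ : X ⟶ A) (ψ : X ⟶ B),
      IsIso (S₁.base.map φ) ∧ S₁.base.map φ ≫ g.hom = S₁.base.map ψ)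
    (hpb : ∀ (A : C₁) {Y : D₁} (f : Y ⟶ S₁.base.obj A),
      ∃ (A' : C₁) (φ : A' ⟶ A) (e : S₁.base.obj A' ≅ Y), S₁.base.map φ = e.hom ≫ f)
    (h2 : Cor411ii S₁ S₂ Ψ) (E : DivisorMonoidIsoOver S₁ S₂ Ψ)
    (hdiv : ∀ ⦃A B : C₁⦄ (φ : A ⟶ B), E.iso A (S₁.div φ) = S₂.div (Ψ.functor.map φ))
    (hdeg : PreservesDegFr S₁ S₂ Ψ) : Cor411iv S₁ S₂ Ψ R₁ R₂ := by
  intro hs _ _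
  obtain ⟨ΨBase, hsq, hrig⟩ := h2 hs
  obtain ⟨η⟩ := hsq.2.1
  obtain ⟨E', hE'⟩ := E.exists_overBase ΨBase η hbase hconn hpb
  haveI := hsq.1
  refine ⟨ΨBase, E', η, hsq.1, hdeg, fun A B φ => ?_, fun h₁ h₂ => hrig h₁ h₂⟩
  rw [hE', ← S₂.pull_comp, Iso.hom_inv_id_app, S₂.pull_id, hdiv]

end TwoFrobenioids

end PreFrobenioidData

namespace PreFrobenioid

section Facts

universe wf vf vf' uf uf'

variable {D₁ : Type uf} [Category.{vf} D₁] {Φ₁ : D₁ᵒᵖ ⥤ CommMonCat.{wf}}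
  {C₁ : Type uf'} [Category.{vf'} C₁] (F₁ : C₁ ⥤ ElemFrobenioid Φ₁)
  {D₂ : Type uf} [Category.{vf} D₂] {Φ₂ : D₂ᵒᵖ ⥤ CommMonCat.{wf}}
  {C₂ : Type uf'} [Category.{vf'} C₂] (F₂ : C₂ ⥤ ElemFrobenioid Φ₂)
  (Ψ : C₁ ≌ C₂)

/-- **Corollary 4.11 (iv)** AS TYPED for Frobenioids `C_i → F_{Φ_i}` with `Φ_i` perf-factorial,
conditional on the named fact [FrdI] Cor. 4.11 (ii) (`FrdI.Cor411ii`), an isomorphism `Ψ^Φ` over `Ψ`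
compatible with divisors (Thm. 4.9 as constructed, p. 89) and "`Ψ` preserves Frobenius degrees"
(Thm. 3.4 (iii)/(iv)). [cite: MochizukiFrdI2008, Cor. 4.11 (iv) p.92] -/
theorem cor411iv_of_fact (h411 : FrdI.Cor411ii.{wf, vf, vf', uf, uf'}) (hF₁ : IsFrobenioid F₁)
    (hF₂ : IsFrobenioid F₂) (hpf₁ : ∀ X : D₁, IsPerfFactorial (Φ₁.obj (op X)))
    (hpf₂ : ∀ X : D₂, IsPerfFactorial (Φ₂.obj (op X)))
    (R₁ : (PreFrobenioidData.ofFunctor Φ₁ F₁).RSParams) (R₂ : (PreFrobenioidData.ofFunctor Φ₂ F₂).RSParams)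
    (E : (PreFrobenioidData.ofFunctor Φ₁ F₁).DivisorMonoidIsoOver (PreFrobenioidData.ofFunctor Φ₂ F₂) Ψ)
    (hdiv : ∀ ⦃A B : C₁⦄ (φ : A ⟶ B), E.iso A (Div F₁ φ) = Div F₂ (Ψ.functor.map φ))
    (hdeg : ∀ ⦃A B : C₁⦄ (φ : A ⟶ B), degFr F₂ (Ψ.functor.map φ) = degFr F₁ φ) :
    (PreFrobenioidData.ofFunctor Φ₁ F₁).Cor411iv (PreFrobenioidData.ofFunctor Φ₂ F₂) Ψ R₁ R₂ :=
  PreFrobenioidData.cor411iv_of_cor411ii _ _ Ψ R₁ R₂ (exists_base_iso_of_isFrobenioid F₁ hF₁)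
    (exists_preSteps_of_base_iso F₁ hF₁) (fun A _ f => exists_arrow_over_base F₁ hF₁ A f)
    (h411 F₁ F₂ hF₁ hF₂ hpf₁ hpf₂ Ψ) E hdiv hdeg

end Facts

end PreFrobenioid

end Literature.AlgebraicGeometry.Frobenioids
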